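import Literature.RepresentationTheory.ModularTensorCategories.SU2FUnitaryKL
import Literature.RepresentationTheory.ModularTensorCategories.SU2Verlinde

/-!
# Column-unitarity of the `SU(2)_k` F-symbols

Topic `Literature/RepresentationTheory/ModularTensorCategories` (definition item `defn-ModularDatum`; step 4
of the transport): `fSym_unitary'` — the `PreModularDatum.F_unitary'` identity
`Σ_e conj(fSym(a,b,c,d,e,f)) fSym(a,b,c,d,e,f') = [f = f' ∧ N_{bc}^f N_{af}^d ≠ 0]` for the unitary
`SU(2)_k` F-symbols, conditional on the printed Kauffman–Lins orthogonality identity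
`KLOrthogonality k`. Proof: for fixed `a,b,c,d` the admissible row labels `e` and column labels `f`
are equinumerous — this is the associativity `Σ_e N_{ab}^e N_{ec}^d = Σ_f N_{bc}^f N_{af}^d`
(`fusionN_assoc`, proved from the Verlinde formula) — so the real matrix of F-symbols, reindexed to a
square matrix by `Fintype.equivOfCardEq`, has orthonormal rows (`fSym_row_sum`) hence orthonormal
columns (`mul_eq_one_comm`). [cite: KauffmanLins1994, §7.3 Prop. 9 = §9.13]
-/

noncomputable section

namespace Literature.RepresentationTheory.ModularTensorCategories.SU2LevelK

open Finset
open scoped ComplexConjugate Matrix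

variable (k : ℕ)

/-- **Column unitarity of the `SU(2)_k` F-symbols** (`PreModularDatum.F_unitary'` form), deduced from row
unitarity (`fSym_row_sum`) by the square-matrix argument: for fixed `a,b,c,d` the admissible row labels
`e` (`(a,b,e),(e,c,d)` admissible) and column labels `f` (`(b,c,f),(a,f,d)` admissible) are equinumerous
(`fusionN_assoc`), and a square real matrix with orthonormal rows has orthonormal columns.
[cite: KauffmanLins1994, §7.3 Prop. 9 = §9.13] -/
theorem fSym_unitary' (hKO : KLOrthogonality k) (a b c d f f' : Fin (k + 1)) :
    ∑ e : Fin (k + 1), conj (fSym k a b c d e f) * fSym k a b c d e f' =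
      if f = f' ∧ fusionN k b c f * fusionN k a f d ≠ 0 then 1 else 0 := by
  -- row / column admissibility and the real entries
  let P : Fin (k + 1) → Prop := fun e => Adm k a b e ∧ Adm k e c d
  let Q : Fin (k + 1) → Prop := fun f => Adm k b c f ∧ Adm k a f d
  let R : Fin (k + 1) → Fin (k + 1) → ℝ := fun e f =>
    if Adm k b c f ∧ Adm k a f d then
      (-1 : ℝ) ^ (((a : ℕ) + b + c + d) / 2) * Real.sqrt (qInt k (e + 1) * qInt k (f + 1)) * sixJ k a b e c d f
    else 0
  have hconj : ∀ (e x : Fin (k + 1)), conj (fSym k a b c d e x) = fSym k a b c d e x := by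
    intro e x; unfold fSym; split_ifs <;> simp [Complex.conj_ofReal]
  have hF : ∀ e x : Fin (k + 1), fSym k a b c d e x = if P e then ((R e x : ℝ) : ℂ) else 0 := by
    intro e x
    unfold fSym
    by_cases hP : P e
    · rw [if_pos hP]
      by_cases hQ : Q x
      · rw [if_pos ⟨hP.1, hP.2, hQ.1, hQ.2⟩]; simp only [R]; rw [if_pos hQ]
      · rw [if_neg (fun h => hQ ⟨h.2.2.1, h.2.2.2⟩)]; simp only [R]; rw [if_neg hQ]; simp
    · rw [if_neg hP, if_neg (fun h => hP ⟨h.1, h.2.1⟩)]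
  have hNQ : fusionN k b c f * fusionN k a f d ≠ 0 ↔ Q f := by
    rw [mul_ne_zero_iff, fusionN_ne_zero_iff, fusionN_ne_zero_iff]
  simp_rw [hconj, hF]
  -- rows are orthonormal
  have hrow : ∀ e e' : Fin (k + 1), P e → P e' →
      ∑ x : Fin (k + 1), R e x * R e' x = if e = e' then 1 else 0 := by
    intro e e' he he'
    have key := fSym_row_sum k hKO he.1 he.2 he'.1 he'.2
    rw [← Fin.sum_univ_eq_sum_range (fun x =>
        (if Adm k b c x ∧ Adm k a x d then
            (-1 : ℝ) ^ (((a : ℕ) + b + c + d) / 2) * Real.sqrt (qInt k (e + 1) * qInt k (x + 1)) *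
              sixJ k a b e c d x else 0) *
        (if Adm k b c x ∧ Adm k a x d then
            (-1 : ℝ) ^ (((a : ℕ) + b + c + d) / 2) * Real.sqrt (qInt k (e' + 1) * qInt k (x + 1)) *
              sixJ k a b e' c d x else 0)) (k + 1)] at key
    rw [show (if e = e' then (1 : ℝ) else 0) = if (e : ℕ) = e' then 1 else 0 by
      simp only [Fin.val_inj]]
    exact key
  -- the square-matrix argument on the subtypes
  let I := {e : Fin (k + 1) // P e}
  let J := {x : Fin (k + 1) // Q x}
  have hcard : Fintype.card I = Fintype.card J := by
    have h := fusionN_assoc k a b c d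
    simp only [I, J, P, Q, Fintype.card_subtype]
    rw [Finset.card_filter, Finset.card_filter]
    have hl : ∀ e : Fin (k + 1), (if Adm k a b e ∧ Adm k e c d then 1 else 0) =
        fusionN k a b e * fusionN k e c d := fun e => by
      unfold fusionN; split_ifs <;> simp_all
    have hr : ∀ x : Fin (k + 1), (if Adm k b c x ∧ Adm k a x d then 1 else 0) =
        fusionN k b c x * fusionN k a x d := fun x => by
      unfold fusionN; split_ifs <;> simp_all
    simp_rw [hl, hr]
    exact h
  let σ : I ≃ J := Fintype.equivOfCardEq hcard
  let M : Matrix I I ℝ := fun e i => R e.1 (σ i).1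
  have hMMt : M * Mᵀ = 1 := by
    ext e e'
    rw [Matrix.mul_apply, Matrix.one_apply]
    simp only [Matrix.transpose_apply, M]
    rw [Equiv.sum_comp σ (fun j : J => R e.1 j.1 * R e'.1 j.1)]
    -- Σ over J = Σ over Fin (the summand vanishes off Q)
    have hsub : ∑ j : J, R e.1 j.1 * R e'.1 j.1 = ∑ x : Fin (k + 1), R e.1 x * R e'.1 x := by
      rw [← Finset.sum_subtype (Finset.univ.filter Q) (fun x => by simp)
        (fun x => R e.1 x * R e'.1 x), Finset.sum_filter]
      refine Finset.sum_congr rfl (fun x _ => ?_)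
      by_cases hQ : Q x
      · rw [if_pos hQ]
      · rw [if_neg hQ]; simp only [R]; rw [if_neg hQ, zero_mul]
    rw [hsub, hrow e.1 e'.1 e.2 e'.2]
    by_cases h : e = e'
    · subst h; simp
    · rw [if_neg (fun h' => h (Subtype.ext h')), if_neg h]
  have hMtM : Mᵀ * M = 1 := mul_eq_one_comm.mp hMMt
  -- columns of R over admissible e are orthonormal
  have hcol : ∀ j j' : J, ∑ e : I, R e.1 j.1 * R e.1 j'.1 = if j = j' then 1 else 0 := by
    intro j j'
    have h := congrFun (congrFun hMtM (σ.symm j)) (σ.symm j')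
    rw [Matrix.mul_apply, Matrix.one_apply] at h
    simp only [Matrix.transpose_apply, M, Equiv.apply_symm_apply] at h
    rw [h]
    by_cases hj : j = j'
    · subst hj; simp
    · rw [if_neg (fun h' => hj (σ.symm.injective h')), if_neg hj]
  -- back to sums over `Fin (k+1)`
  by_cases hQf : Q f
  · by_cases hQf' : Q f'
    · have h := hcol ⟨f, hQf⟩ ⟨f', hQf'⟩
      have hsub : ∑ e : I, R e.1 f * R e.1 f' =
          ∑ e : Fin (k + 1), (if P e then R e f * R e f' else 0) := by
        rw [← Finset.sum_subtype (Finset.univ.filter P) (fun x => by simp) (fun e => R e f * R e f'),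
          Finset.sum_filter]
      rw [hsub] at h
      have hC : ∑ e : Fin (k + 1), (if P e then ((R e f : ℝ) : ℂ) else 0) *
            (if P e then ((R e f' : ℝ) : ℂ) else 0) =
          ((∑ e : Fin (k + 1), (if P e then R e f * R e f' else 0) : ℝ) : ℂ) := by
        rw [Complex.ofReal_sum]
        refine Finset.sum_congr rfl (fun e _ => ?_)
        by_cases hP : P e
        · rw [if_pos hP, if_pos hP, if_pos hP]; push_cast; ring
        · rw [if_neg hP, if_neg hP, if_neg hP]; simp
      rw [hC, h]
      by_cases hff : f = f'
      · subst hff; rw [if_pos rfl, if_pos ⟨rfl, hNQ.mpr hQf⟩]; simp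
      · rw [if_neg (fun h' => hff (congrArg Subtype.val h')), if_neg (fun h' => hff h'.1)]; simp
    · have h0 : ∀ e : Fin (k + 1), (if P e then ((R e f' : ℝ) : ℂ) else 0) = 0 := fun e => by
        by_cases hP : P e
        · rw [if_pos hP]; simp only [R]; rw [if_neg hQf']; simp
        · rw [if_neg hP]
      simp_rw [h0, mul_zero, Finset.sum_const_zero]
      rw [if_neg]
      rintro ⟨rfl, -⟩
      exact hQf' hQf
  · have h0 : ∀ e : Fin (k + 1), (if P e then ((R e f : ℝ) : ℂ) else 0) = 0 := fun e => by
      by_cases hP : P e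
      · rw [if_pos hP]; simp only [R]; rw [if_neg hQf]; simp
      · rw [if_neg hP]
    simp_rw [h0, zero_mul, Finset.sum_const_zero]
    rw [if_neg (fun h => hQf (hNQ.mp h.2))]

end Literature.RepresentationTheory.ModularTensorCategories.SU2LevelK
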